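import Summits.CriticalPhenomena.PercolationContinuityZ3.Theorems.PercNearOneGluingNoHeavyLowerTailAntiBandSingleLevel

/-!
# `NoHeavyLowerTail` (crux stmt-CriticalPhenomena-4575), lane prim-ineq-gen-4 (gen 27): (AB_l) with ONE set below the top small level — ALL `l ≥ 2`, ALL `|β| ≥ 2l`

Support file (`--supports stmt-CriticalPhenomena-4575`; memo `run/shared/lean/prim/prim-ineq-gen-4/FINDING-OFFDIAG-UNIVERSAL-g27.md` §0(5)).  No definitions, no `sorry`,
standard axioms.  Uses the lemmas `quadForm_binomial_nonneg_and_pos` (positive (semi)definiteness of the binomial matrix on vectors supported on `k`-sets) and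
`sunflower_choose_ineq` of `AntiBandSingleLevel`.

For `U = 𝒰 ∪ {y}` with `𝒰` a family of `k`-sets containing every `k`-superset of the `(k−1)`-set `y` (`|β| = 2k+1+N`, `N ≥ 1`), the binomial matrix
`M_U = [C(|β|−1−#(x∪x'), k)]` is nonsingular (`det_binomial_ne_zero_of_one_below`): a null vector `c` must have `a := c_y ≠ 0` (positive definiteness on the
`k`-sets), and the vector `w = q'·(c − a e_y) + aC·1_S` (`S` = the `μ = N+k+2` supersets of `y`, `C = C(N+k,k)`, `C' = C(N+k−1,k)`, `C'' = C(N+k+1,k)`,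
`q' = C + (μ−1)C'`) is supported on `k`-sets with `wᵀ M_U w = a²·q'·(q'C'' − μC²) ≥ 0`, contradicting the sunflower inequality `q'C'' < μC²`
(`μC²(N+1)(N+k) − q'C''(N+1)(N+k) = k·C²`).  With the determinant criterion (gen 21, p325588) this gives `antiBand_of_one_below`:
**(AB_l) for every `l ≥ 2`, every `|β| ≥ 2l`, every upper set `A` whose members other than one `(l−2)`-set `y ∈ A` all have size `≥ l−1`, every upper `V`**
— the first mixed-level class of the anti-band inequality proved in every dimension (the single-level class is `AntiBandSingleLevel.antiBand_of_le_card`).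
-/

namespace Summit.CriticalPhenomena.PercolationContinuityZ3.Theorems.AntiBandOneBelow

open Finset Matrix
open scoped FinsetFamily
open Summit.CriticalPhenomena.PercolationContinuityZ3.Theorems.AntiBandSingleLevel

variable {β : Type*} [DecidableEq β] [Fintype β]

/-- The number of `m`-subsets of `β` containing a fixed finset `w` with `#w ≤ m` is `C(|β| − #w, m − #w)`. [elementary; private copy of
`AntiBandMiddleLevel.card_filter_powersetCard_superset`] -/
private theorem card_filter_powersetCard_superset'' (w : Finset β) (m : ℕ) (hw : #w ≤ m) :
    #(((univ : Finset β).powersetCard m).filter (fun y => w ⊆ y)) = (Fintype.card β - #w).choose (m - #w) := by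
  rw [← Finset.card_compl w, ← Finset.card_powersetCard (m - #w) wᶜ]
  symm
  apply Finset.card_bij' (fun u _ => u ∪ w) (fun y _ => y \ w)
  · intro u hu
    rw [mem_powersetCard] at hu
    have hdisj : Disjoint u w := by
      rw [← Finset.subset_compl_iff_disjoint_right]; exact hu.1
    rw [mem_filter, mem_powersetCard]
    refine ⟨⟨subset_univ _, ?_⟩, subset_union_right⟩
    rw [card_union_of_disjoint hdisj, hu.2]
    omega
  · intro y hy
    rw [mem_filter, mem_powersetCard] at hy
    rw [mem_powersetCard]
    refine ⟨?_, ?_⟩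
    · intro a ha
      rw [mem_sdiff] at ha
      rw [mem_compl]
      exact ha.2
    · rw [card_sdiff_of_subset hy.2, hy.1.2]
  · intro u hu
    rw [mem_powersetCard] at hu
    have hdisj : Disjoint u w := by
      rw [← Finset.subset_compl_iff_disjoint_right]; exact hu.1
    exact Finset.union_sdiff_cancel_right hdisj
  · intro y hy
    rw [mem_filter] at hy
    exact Finset.sdiff_union_of_subset hy.2

/-- **Nonsingularity one level below the top — every `k ≥ 1`, every `|β| ≥ 2k+2`.**  Let `U` consist of a `(k−1)`-set `y` together with `k`-sets, among them EVERY
`k`-superset of `y`.  Then `det [C(|β|−1−#(x∪x'), k)]_{x,x'∈U} ≠ 0`.  Proof: a null vector `c` must have `a := c_y ≠ 0` (positive definiteness on the `k`-sets,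
`quadForm_binomial_nonneg_and_pos`); the vector `w = q'·(c − a e_y) + aC·1_S` is supported on `k`-sets and `wᵀMw = a² q' (q' C'' − μ C²) ≥ 0` contradicts
`sunflower_choose_ineq`. [gen 27, memo FINDING-OFFDIAG-UNIVERSAL-g27 §0(5)] -/
theorem det_binomial_ne_zero_of_one_below (k : ℕ) (hk : 1 ≤ k) (U : Finset (Finset β)) (y : Finset β) (hy : y ∈ U) (hyk : #y = k - 1)
    (hU : ∀ x ∈ U, x = y ∨ #x = k) (hsup : ∀ x : Finset β, y ⊆ x → #x = k → x ∈ U)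
    (hβ : 2 * k + 2 ≤ Fintype.card β) :
    (Matrix.of fun (x x' : ↥U) => ((Fintype.card β - 1 - #((x : Finset β) ∪ x')).choose k : ℤ)).det ≠ 0 := by
  classical
  set n := Fintype.card β with hn
  set M : Matrix ↥U ↥U ℤ := Matrix.of fun (x x' : ↥U) => ((n - 1 - #((x : Finset β) ∪ x')).choose k : ℤ) with hMdef
  intro hdet
  obtain ⟨c, hc, hMc⟩ := Matrix.exists_mulVec_eq_zero_iff.mpr hdet
  set y₀ : ↥U := ⟨y, hy⟩ with hy₀def
  set a : ℤ := c y₀ with hadef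
  have hrow : ∀ x : ↥U, ∑ x' : ↥U, M x x' * c x' = 0 := by
    intro x
    have := congrFun hMc x
    simpa [Matrix.mulVec, dotProduct] using this
  have hynotk : #y ≠ k := by rw [hyk]; omega
  have hothers : ∀ x : ↥U, x ≠ y₀ → #(x : Finset β) = k := by
    intro x hx
    rcases hU x x.2 with h | h
    · exact absurd (Subtype.ext h) hx
    · exact h
  have hPSD := quadForm_binomial_nonneg_and_pos k U (by omega)
  by_cases ha : a = 0
  · -- `c` is supported on the `k`-sets: contradiction with positive definiteness there
    have hsupp : ∀ x : ↥U, #(x : Finset β) ≠ k → c x = 0 := by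
      intro x hx
      have hxy : x = y₀ := by
        by_contra h
        exact hx (hothers x h)
      rw [hxy]; exact ha
    obtain ⟨x₁, hx₁⟩ : ∃ x₁ : ↥U, c x₁ ≠ 0 := by
      by_contra h
      exact hc (funext fun x => not_not.mp (not_exists.mp h x))
    have hpos := (hPSD c hsupp).2 ⟨x₁, hx₁⟩
    rw [hMc, dotProduct_zero] at hpos
    exact lt_irrefl _ hpos
  · -- constants
    set Nn := n - 2 * k - 1 with hNndef
    have hNn1 : 1 ≤ Nn := by omega
    set C : ℤ := ((Nn + k).choose k : ℤ) with hCdef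
    set C' : ℤ := ((Nn + k - 1).choose k : ℤ) with hC'def
    set C'' : ℤ := ((Nn + k + 1).choose k : ℤ) with hC''def
    set μ : ℤ := (Nn : ℤ) + k + 2 with hμdef
    set q' : ℤ := C + ((Nn : ℤ) + k + 1) * C' with hq'def
    -- the indicator of the `k`-supersets of `y`, and `c` with its `y`-coordinate removed
    set σ : ↥U → ℤ := fun x => if #(x : Finset β) = k ∧ y ⊆ (x : Finset β) then 1 else 0 with hσdef
    set c' : ↥U → ℤ := c - a • (Pi.single y₀ (1 : ℤ)) with hc'def
    have hc'y : c' y₀ = 0 := by simp [hc'def, hadef]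
    have hσy : σ y₀ = 0 := by
      simp only [hσdef, hy₀def]
      rw [if_neg]
      intro h; exact hynotk h.1
    -- entries of `M` against `y₀` and inside the sunflower
    have hMyy : M y₀ y₀ = C'' := by
      simp only [hMdef, of_apply, hy₀def, Finset.union_idempotent, hC''def]
      congr 2; omega
    have hMxy : ∀ x : ↥U, #(x : Finset β) = k → y ⊆ (x : Finset β) → M x y₀ = C := by
      intro x hxk hyx
      have hu : (x : Finset β) ∪ y = x := Finset.union_eq_left.mpr hyx
      simp only [hMdef, of_apply, hy₀def, hu, hxk, hCdef]
      congr 2; omega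
    have hMdiag : ∀ x : ↥U, #(x : Finset β) = k → M x x = C := by
      intro x hxk
      simp only [hMdef, of_apply, Finset.union_idempotent, hxk, hCdef]
      congr 2; omega
    have hMxx' : ∀ x x' : ↥U, #(x : Finset β) = k → y ⊆ (x : Finset β) → #(x' : Finset β) = k → y ⊆ (x' : Finset β) → x ≠ x' →
        M x x' = C' := by
      intro x x' hxk hyx hx'k hyx' hne
      have hne' : (x : Finset β) ≠ (x' : Finset β) := fun h => hne (Subtype.ext h)
      have hinter_ge : k - 1 ≤ #((x : Finset β) ∩ x') := by
        rw [← hyk]; exact Finset.card_le_card (Finset.subset_inter hyx hyx')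
      have hinter_lt : #((x : Finset β) ∩ x') < k := by
        have hss : (x : Finset β) ∩ x' ⊂ x := by
          refine Finset.ssubset_iff_subset_ne.mpr ⟨inter_subset_left, ?_⟩
          intro h
          have hsub : (x : Finset β) ⊆ x' := by rw [← h]; exact inter_subset_right
          exact hne' (Finset.eq_of_subset_of_card_le hsub (by rw [hxk, hx'k]))
        have := Finset.card_lt_card hss
        rwa [hxk] at this
      have hu : #((x : Finset β) ∪ x') = k + 1 := by
        have := Finset.card_union_add_card_inter (x : Finset β) x'
        rw [hxk, hx'k] at this; omega
      simp only [hMdef, of_apply, hu, hC'def]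
      congr 2; omega
    have hMsymm : ∀ x x' : ↥U, M x x' = M x' x := by
      intro x x'; simp only [hMdef, of_apply, Finset.union_comm]
    -- counting the sunflower: Σ σ = μ
    have hσsum : ∑ x : ↥U, σ x = μ := by
      have h1 : ∑ x : ↥U, σ x = ∑ s ∈ U, (if #s = k ∧ y ⊆ s then (1 : ℤ) else 0) := by
        rw [hσdef]
        exact Finset.sum_coe_sort U (fun s => if #s = k ∧ y ⊆ s then (1 : ℤ) else 0)
      have h2 : U.filter (fun s => #s = k ∧ y ⊆ s) = ((univ : Finset β).powersetCard k).filter (fun s => y ⊆ s) := by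
        ext s
        rw [mem_filter, mem_filter, mem_powersetCard]
        constructor
        · rintro ⟨-, hs, hys⟩; exact ⟨⟨subset_univ _, hs⟩, hys⟩
        · rintro ⟨⟨-, hs⟩, hys⟩; exact ⟨hsup s hys hs, hs, hys⟩
      rw [h1, Finset.sum_boole, h2, card_filter_powersetCard_superset'' y k (by omega), hyk, hμdef]
      have e : k - (k - 1) = 1 := by omega
      rw [e, Nat.choose_one_right]
      have : n - (k - 1) = Nn + k + 2 := by omega
      rw [← hn, this]
      push_cast; ring
    -- Σ σ·M(·,y₀) = μ C
    have hσcol : ∑ x : ↥U, σ x * M x y₀ = μ * C := by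
      have : ∀ x : ↥U, σ x * M x y₀ = σ x * C := by
        intro x
        by_cases h : #(x : Finset β) = k ∧ y ⊆ (x : Finset β)
        · rw [hMxy x h.1 h.2]
        · simp only [hσdef, if_neg h, zero_mul]
      rw [Finset.sum_congr rfl (fun x _ => this x), ← Finset.sum_mul, hσsum]
    -- row sums of `M` on the sunflower: Σ_{x'} M x x' σ x' = q' for x in the sunflower
    have hrowσ : ∀ x : ↥U, #(x : Finset β) = k → y ⊆ (x : Finset β) → ∑ x' : ↥U, M x x' * σ x' = q' := by
      intro x hxk hyx
      have hsplit := Finset.sum_erase_add (univ : Finset ↥U) (fun x' => M x x' * σ x') (mem_univ x)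
      rw [← hsplit]
      have hx1 : σ x = 1 := by simp only [hσdef, if_pos (And.intro hxk hyx)]
      have hrest : ∑ x' ∈ (univ : Finset ↥U).erase x, M x x' * σ x' = ∑ x' ∈ (univ : Finset ↥U).erase x, C' * σ x' := by
        apply Finset.sum_congr rfl
        intro x' hx'
        rw [mem_erase] at hx'
        by_cases h : #(x' : Finset β) = k ∧ y ⊆ (x' : Finset β)
        · rw [hMxx' x x' hxk hyx h.1 h.2 (Ne.symm hx'.1)]
        · simp only [hσdef, if_neg h, mul_zero]
      have herase : ∑ x' ∈ (univ : Finset ↥U).erase x, σ x' = μ - 1 := by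
        have := Finset.sum_erase_add (univ : Finset ↥U) σ (mem_univ x)
        rw [hσsum, hx1] at this
        linarith
      rw [hrest, ← Finset.mul_sum, herase, hMdiag x hxk, hx1, hq'def]
      ring
    have hσMσ : σ ⬝ᵥ (M *ᵥ σ) = μ * q' := by
      have h1 : σ ⬝ᵥ (M *ᵥ σ) = ∑ x : ↥U, σ x * q' := by
        simp only [dotProduct, Matrix.mulVec]
        apply Finset.sum_congr rfl
        intro x _
        by_cases h : #(x : Finset β) = k ∧ y ⊆ (x : Finset β)
        · rw [hrowσ x h.1 h.2]
        · simp only [hσdef, if_neg h, zero_mul]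
      rw [h1, ← Finset.sum_mul, hσsum]
    -- `M c' = -a • col y₀`
    have hMc' : M *ᵥ c' = -a • (fun x => M x y₀) := by
      rw [hc'def, Matrix.mulVec_sub, hMc, Matrix.mulVec_smul, Matrix.mulVec_single_one, zero_sub, ← neg_smul]
      rfl
    have hccol : ∑ x : ↥U, c x * M x y₀ = 0 := by
      rw [← hrow y₀]
      apply Finset.sum_congr rfl
      intro x _
      rw [hMsymm x y₀, mul_comm]
    have hc'col : c' ⬝ᵥ (fun x => M x y₀) = -a * C'' := by
      rw [hc'def, sub_dotProduct, smul_dotProduct, single_one_dotProduct, smul_eq_mul, hMyy]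
      simp only [dotProduct]
      rw [hccol]; ring
    have hc'Mc' : c' ⬝ᵥ (M *ᵥ c') = a ^ 2 * C'' := by
      rw [hMc', dotProduct_smul, smul_eq_mul, hc'col]; ring
    have hσMc' : σ ⬝ᵥ (M *ᵥ c') = -a * (μ * C) := by
      rw [hMc', dotProduct_smul, smul_eq_mul]
      simp only [dotProduct]
      rw [hσcol]
    have hc'Mσ : c' ⬝ᵥ (M *ᵥ σ) = -a * (μ * C) := by
      rw [← hσMc']
      simp only [dotProduct, Matrix.mulVec, Finset.mul_sum]
      rw [Finset.sum_comm]
      apply Finset.sum_congr rfl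
      intro x _
      apply Finset.sum_congr rfl
      intro x' _
      rw [hMsymm x' x]; ring
    -- the test vector
    set w : ↥U → ℤ := q' • c' + (a * C) • σ with hwdef
    have hwsupp : ∀ x : ↥U, #(x : Finset β) ≠ k → w x = 0 := by
      intro x hx
      have hxy : x = y₀ := by
        by_contra h
        exact hx (hothers x h)
      simp only [hwdef, Pi.add_apply, Pi.smul_apply, smul_eq_mul, hxy, hc'y, hσy, mul_zero, add_zero]
    have hnonneg := (hPSD w hwsupp).1
    have hval : w ⬝ᵥ (M *ᵥ w) = a ^ 2 * q' * (q' * C'' - μ * C ^ 2) := by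
      rw [hwdef, Matrix.mulVec_add, Matrix.mulVec_smul, Matrix.mulVec_smul, add_dotProduct, dotProduct_add, dotProduct_add,
        smul_dotProduct, smul_dotProduct, smul_dotProduct, smul_dotProduct, dotProduct_smul, dotProduct_smul, dotProduct_smul, dotProduct_smul,
        hc'Mc', hc'Mσ, hσMc', hσMσ]
      simp only [smul_eq_mul]
      ring
    have hq' : 0 < q' := by
      have h1 : (0 : ℤ) < C := by
        have : 0 < (Nn + k).choose k := Nat.choose_pos (by omega)
        rw [hCdef]; exact_mod_cast this
      have h2 : (0 : ℤ) ≤ C' := by rw [hC'def]; positivity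
      have h3 : (0 : ℤ) ≤ ((Nn : ℤ) + k + 1) * C' := by positivity
      rw [hq'def]; linarith
    have ha2 : 0 < a ^ 2 := lt_of_le_of_ne (sq_nonneg a) (Ne.symm (pow_ne_zero 2 ha))
    have hineq := sunflower_choose_ineq Nn k hNn1 hk
    rw [hval] at hnonneg
    -- a² q' (q' C'' − μ C²) ≥ 0 with a² q' > 0 forces q' C'' ≥ μ C², contradicting the sunflower inequality
    have hprod : 0 < a ^ 2 * q' := mul_pos ha2 hq'
    have hge : 0 ≤ q' * C'' - μ * C ^ 2 := by
      by_contra h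
      rw [not_le] at h
      have := mul_neg_of_pos_of_neg hprod h
      linarith
    rw [hμdef, hq'def] at hge
    linarith

/-- **(AB_l) with one set below — every `l ≥ 2`, every `|β| ≥ 2l`.**  If `A`, `V` are upper sets of finsets of `β`, `2l ≤ |β|`, and the members of `A` of size `< l` are
sets of size `l−1` together with at most one set `y` of size `l−2` (precisely: every member of `A` other than `y` has size `≥ l−1`), then
`#{s ∈ A ∩ Vᶜˢ | #s < l ∨ #sᶜ < l} ≤ #{s ∈ A ∩ V | #s < l ∨ #sᶜ < l}`.  [gen 27; `det_binomial_ne_zero_of_one_below` + the determinant criterion p325588] -/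
theorem antiBand_of_one_below (l : ℕ) (hl : 2 ≤ l) (A V : Finset (Finset β))
    (hA : IsUpperSet (A : Set (Finset β))) (hV : IsUpperSet (V : Set (Finset β))) (hβ : 2 * l ≤ Fintype.card β)
    (y : Finset β) (hy : y ∈ A) (hyl : #y = l - 2) (hmin : ∀ s ∈ A, s ≠ y → l - 1 ≤ #s) :
    #((A ∩ Vᶜˢ).filter fun s => #s < l ∨ #sᶜ < l) ≤ #((A ∩ V).filter fun s => #s < l ∨ #sᶜ < l) := by
  apply AntiBandDetCriterion.antiBand_of_det_binomial_ne_zero l (by omega) A V hA hV hβ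
  apply det_binomial_ne_zero_of_one_below (l - 1) (by omega) (A.filter fun s => #s < l) y
  · rw [mem_filter]; exact ⟨hy, by omega⟩
  · rw [hyl]; omega
  · intro x hx
    rw [mem_filter] at hx
    by_cases hxy : x = y
    · exact Or.inl hxy
    · right
      have := hmin x hx.1 hxy
      omega
  · intro x hyx hxk
    rw [mem_filter]
    refine ⟨hA hyx hy, by omega⟩
  · omega

end Summit.CriticalPhenomena.PercolationContinuityZ3.Theorems.AntiBandOneBelow
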